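import Summits.CriticalPhenomena.CardyFormulaZ2.Theorems.CardyFlipRussoVoronoiHubFromSmirnovOneArmScales
import Summits.CriticalPhenomena.CardyFormulaZ2.Theorems.CardyFlipRussoVoronoiHubFromSmirnovTendstoLogPow
import Mathlib.Analysis.SpecialFunctions.Pow.Asymptotics
import Mathlib.Analysis.SpecialFunctions.Pow.Continuity
import Mathlib.Analysis.SpecialFunctions.Log.Basic
import Mathlib.Topology.MetricSpace.Pseudo.Lemmas
import HarnessLib

/-!
# The final error of the one-arm route tends to zero (lead c3; proof by stub-worker `fs`, finished by the lead)

Line `moebius-exact-delaunay-dilation-ward` of crux `VoronoiHubFromSmirnov` (stmt-CriticalPhenomena-6433).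
On the explicit scales of `…OneArmScales` (`rvS δ = 6√|log δ|`, square side `A·rvS`, tolerances `τS`,
`τS'`, defect bound `pS = O(δ² |log δ|⁸)`, void bound `vS = O(δ^{4π−2})`, arm factor
`BS = O((δ|log δ|)^{ηa/2})`, counts `NS = O(δ⁻¹)`, `cardS = O(δ⁻²)`), the final error
`FS = vS + cardS·(3 pS BS + NS pS² BS + NS² pS³)` tends to `0` as `δ → 0⁺` (registered stub
`FS_tendsto_zero`, the last analytic input of `unitW_of_inputs`).  Tool: the landed
`tendsto_const_mul_log_pow_mul_rpow` (`C |log δ|^k δ^s → 0`).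
-/

noncomputable section

namespace Summit.CriticalPhenomena.CardyFormulaZ2.Cruxes.VoronoiHubFromSmirnov.MoebiusExactDelaunayDilationWard

open Filter
open scoped Topology

/-- Eventually (as `δ → 0⁺`): `0 < δ < 1`, `|log δ| ≥ 1` and `rvS δ ≥ 6`. -/
theorem eventually_mesh_small :
    ∀ᶠ δ in 𝓝[>] (0 : ℝ), 0 < δ ∧ δ < 1 ∧ 1 ≤ |Real.log δ| ∧ 6 ≤ rvS δ := by
  have h : Set.Ioo (0 : ℝ) (Real.exp (-1)) ∈ 𝓝[>] (0 : ℝ) := Ioo_mem_nhdsGT (Real.exp_pos _)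
  filter_upwards [h] with δ hδ
  rcases hδ with ⟨h0, h1⟩
  have hlt1 : Real.exp (-1) < 1 := Real.exp_lt_one_iff.mpr (by norm_num)
  have hlog : Real.log δ < -1 := (Real.log_lt_iff_lt_exp h0).mpr h1
  have hL : 1 ≤ |Real.log δ| := by
    rw [abs_of_neg (by linarith)]
    linarith
  refine ⟨h0, h1.trans hlt1, hL, ?_⟩
  have : 1 ≤ Real.sqrt |Real.log δ| := Real.one_le_sqrt.mpr hL
  unfold rvS
  linarith

/-- `δ^s · (rvS δ)^n → 0` for `s > 0` (powers of `√|log δ|` lose against any power of `δ`). -/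
theorem tendsto_rpow_mul_rvS_pow (s : ℝ) (n : ℕ) (hs : 0 < s) :
    Tendsto (fun δ : ℝ => δ ^ s * rvS δ ^ n) (𝓝[>] 0) (𝓝 0) := by
  have hmaj := tendsto_const_mul_log_pow_mul_rpow ((6 : ℝ) ^ n) s n hs
  refine squeeze_zero' ?_ ?_ hmaj
  · filter_upwards [self_mem_nhdsWithin] with δ hδ
    exact mul_nonneg (Real.rpow_nonneg (le_of_lt hδ) _) (pow_nonneg (rvS_nonneg δ) _)
  · filter_upwards [eventually_mesh_small] with δ ⟨hδ, _, hL, _⟩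
    have hr : rvS δ ≤ 6 * |Real.log δ| := by
      have h1 : Real.sqrt |Real.log δ| ≤ |Real.log δ| := by
        rw [Real.sqrt_le_left (by positivity)]
        nlinarith
      unfold rvS
      linarith
    calc δ ^ s * rvS δ ^ n ≤ δ ^ s * (6 * |Real.log δ|) ^ n :=
          mul_le_mul_of_nonneg_left (pow_le_pow_left₀ (rvS_nonneg δ) hr n)
            (Real.rpow_nonneg hδ.le s)
      _ = 6 ^ n * |Real.log δ| ^ n * δ ^ s := by ring

/-- The void bound `vS` is nonnegative. -/
theorem vS_nonneg' (ρ₀ δ : ℝ) : 0 ≤ vS ρ₀ δ := by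
  unfold vS; positivity

/-- `exp(−π (rvS δ/3)²) = δ^{4π}` for `0 < δ < 1`. -/
theorem exp_rvS_eq (δ : ℝ) (hδ : 0 < δ) (hδ1 : δ < 1) :
    Real.exp (-(Real.pi * (rvS δ / 3) ^ 2)) = δ ^ (4 * Real.pi) := by
  have hL : 0 ≤ |Real.log δ| := abs_nonneg _
  have h1 : (rvS δ / 3) ^ 2 = 4 * |Real.log δ| := by
    unfold rvS
    rw [show 6 * Real.sqrt |Real.log δ| / 3 = 2 * Real.sqrt |Real.log δ| by ring, mul_pow,
      Real.sq_sqrt hL]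
    ring
  rw [h1, abs_of_neg (Real.log_neg hδ hδ1), Real.rpow_def_of_pos hδ]
  congr 1
  ring

/-- Majorant of the void bound: `vS ≤ (2ρ₀ + 1)² δ^{4π−2}`. -/
theorem vS_le (ρ₀ δ : ℝ) (hρ : 0 ≤ ρ₀) (hδ : 0 < δ) (hδ1 : δ < 1) (hr : 6 ≤ rvS δ) :
    vS ρ₀ δ ≤ (2 * ρ₀ + 1) ^ 2 * δ ^ (4 * Real.pi - 2) := by
  unfold vS
  rw [exp_rvS_eq δ hδ hδ1]
  have hr0 : 0 < rvS δ := by linarith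
  have h1 : 12 * (ρ₀ / δ) / rvS δ + 1 ≤ (2 * ρ₀ + 1) / δ := by
    have ha : 12 * (ρ₀ / δ) / rvS δ ≤ 2 * ρ₀ / δ := by
      rw [div_le_iff₀ hr0]
      have : 0 ≤ ρ₀ / δ := by positivity
      have h' : 2 * ρ₀ / δ * rvS δ = 2 * (ρ₀ / δ) * rvS δ := by ring
      rw [h']
      nlinarith
    have hb : (1 : ℝ) ≤ 1 / δ := by
      rw [le_div_iff₀ hδ]; linarith
    calc 12 * (ρ₀ / δ) / rvS δ + 1 ≤ 2 * ρ₀ / δ + 1 / δ := add_le_add ha hb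
      _ = (2 * ρ₀ + 1) / δ := by ring
  have h0 : 0 ≤ 12 * (ρ₀ / δ) / rvS δ + 1 := by positivity
  calc (12 * (ρ₀ / δ) / rvS δ + 1) ^ 2 * δ ^ (4 * Real.pi)
      ≤ ((2 * ρ₀ + 1) / δ) ^ 2 * δ ^ (4 * Real.pi) :=
        mul_le_mul_of_nonneg_right (pow_le_pow_left₀ h0 h1 2) (Real.rpow_nonneg hδ.le _)
    _ = (2 * ρ₀ + 1) ^ 2 * δ ^ (4 * Real.pi - 2) := by
        rw [Real.rpow_sub hδ, Real.rpow_two, div_pow]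
        field_simp

/-- `(rvS δ)^k · vS → 0`. -/
theorem tendsto_rvS_pow_mul_vS (ρ₀ : ℝ) (hρ : 0 ≤ ρ₀) (k : ℕ) :
    Tendsto (fun δ : ℝ => rvS δ ^ k * vS ρ₀ δ) (𝓝[>] 0) (𝓝 0) := by
  have hs : 0 < 4 * Real.pi - 2 := by linarith [Real.pi_gt_three]
  have hmaj := (tendsto_rpow_mul_rvS_pow (4 * Real.pi - 2) k hs).const_mul ((2 * ρ₀ + 1) ^ 2)
  rw [mul_zero] at hmaj
  refine squeeze_zero' ?_ ?_ hmaj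
  · filter_upwards [self_mem_nhdsWithin] with δ _
    exact mul_nonneg (pow_nonneg (rvS_nonneg δ) _) (vS_nonneg' ρ₀ δ)
  · filter_upwards [eventually_mesh_small] with δ ⟨hδ, hδ1, _, hr6⟩
    calc rvS δ ^ k * vS ρ₀ δ ≤ rvS δ ^ k * ((2 * ρ₀ + 1) ^ 2 * δ ^ (4 * Real.pi - 2)) :=
          mul_le_mul_of_nonneg_left (vS_le ρ₀ δ hρ hδ hδ1 hr6) (pow_nonneg (rvS_nonneg δ) k)
      _ = (2 * ρ₀ + 1) ^ 2 * (δ ^ (4 * Real.pi - 2) * rvS δ ^ k) := by ring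

/-- The arm factor `BS` is nonnegative. -/
theorem BS_nonneg' (A Ca ηa ρ₀ δ : ℝ) (hA : 0 ≤ A) (hCa : 0 ≤ Ca) : 0 ≤ BS A Ca ηa ρ₀ δ := by
  have hv := vS_nonneg' ρ₀ δ
  have hr := rvS_nonneg δ
  have hR : 0 ≤ RS δ := by unfold RS; positivity
  unfold BS
  positivity

/-- `(rvS δ)^k · BS → 0` (one-arm decay beats polylog). -/
theorem tendsto_rvS_pow_mul_BS (A Ca ηa ρ₀ : ℝ) (hA : 0 < A) (hCa : 0 ≤ Ca) (hη : 0 < ηa)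
    (hρ : 0 < ρ₀) :
    Tendsto (fun δ : ℝ => rvS δ ^ 12 * BS A Ca ηa ρ₀ δ) (𝓝[>] 0) (𝓝 0) := by
  set N : ℕ := ⌈12 / ηa⌉₊ with hN
  have hNη : (12 : ℝ) ≤ N * ηa := by
    have : 12 / ηa ≤ N := Nat.le_ceil _
    rwa [div_le_iff₀ hη] at this
  have hv0 : Tendsto (fun δ : ℝ => vS ρ₀ δ) (𝓝[>] 0) (𝓝 0) := by
    simpa using tendsto_rvS_pow_mul_vS ρ₀ hρ.le 0
  have hv12 := tendsto_rvS_pow_mul_vS ρ₀ hρ.le 12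
  have hg : Tendsto (fun δ : ℝ => (400 * A * (δ ^ (1 / 2 : ℝ) * rvS δ ^ (N + 1))) ^ ηa)
      (𝓝[>] 0) (𝓝 0) := by
    have h := ((tendsto_rpow_mul_rvS_pow (1 / 2) (N + 1) one_half_pos).const_mul
      (400 * A)).rpow_const (Or.inr hη.le)
    rwa [mul_zero, Real.zero_rpow hη.ne'] at h
  have hmaj : Tendsto (fun δ : ℝ => (Ca + vS ρ₀ δ + 1) ^ 2 *
      ((400 * A * (δ ^ (1 / 2 : ℝ) * rvS δ ^ (N + 1))) ^ ηa + rvS δ ^ 12 * vS ρ₀ δ))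
      (𝓝[>] 0) (𝓝 0) := by
    have := (((tendsto_const_nhds (x := Ca)).add hv0).add
      (tendsto_const_nhds (x := (1 : ℝ)))).pow 2 |>.mul (hg.add hv12)
    simpa using this
  refine squeeze_zero' ?_ ?_ hmaj
  · filter_upwards [self_mem_nhdsWithin] with δ _
    exact mul_nonneg (pow_nonneg (rvS_nonneg δ) _) (BS_nonneg' A Ca ηa ρ₀ δ hA.le hCa)
  · filter_upwards [eventually_mesh_small] with δ ⟨hδ, _, _, hr6⟩
    have hr1 : 1 ≤ rvS δ := by linarith
    have hr0 : 0 ≤ rvS δ := by linarith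
    have hbase : 400 * (A * rvS δ) / RS δ = 400 * A * (δ ^ (1 / 2 : ℝ) * rvS δ) := by
      unfold RS
      rw [Real.sqrt_eq_rpow, div_inv_eq_mul]
      ring
    have hkey : rvS δ ^ 12 * (400 * (A * rvS δ) / RS δ) ^ ηa ≤
        (400 * A * (δ ^ (1 / 2 : ℝ) * rvS δ ^ (N + 1))) ^ ηa := by
      rw [hbase]
      have h1 : rvS δ ^ 12 ≤ (rvS δ ^ N) ^ ηa := by
        rw [← Real.rpow_natCast_mul hr0, ← Real.rpow_natCast (rvS δ) 12]
        exact Real.rpow_le_rpow_of_exponent_le hr1 (by exact_mod_cast hNη)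
      calc rvS δ ^ 12 * (400 * A * (δ ^ (1 / 2 : ℝ) * rvS δ)) ^ ηa
          ≤ (rvS δ ^ N) ^ ηa * (400 * A * (δ ^ (1 / 2 : ℝ) * rvS δ)) ^ ηa :=
            mul_le_mul_of_nonneg_right h1 (by positivity)
        _ = (rvS δ ^ N * (400 * A * (δ ^ (1 / 2 : ℝ) * rvS δ))) ^ ηa :=
            (Real.mul_rpow (pow_nonneg hr0 N) (by positivity)).symm
        _ = (400 * A * (δ ^ (1 / 2 : ℝ) * rvS δ ^ (N + 1))) ^ ηa := by
            congr 1; ring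
    have hv := vS_nonneg' ρ₀ δ
    unfold BS
    calc rvS δ ^ 12 * ((Ca + vS ρ₀ δ + 1) ^ 2 * ((400 * (A * rvS δ) / RS δ) ^ ηa + vS ρ₀ δ))
        = (Ca + vS ρ₀ δ + 1) ^ 2 *
            (rvS δ ^ 12 * (400 * (A * rvS δ) / RS δ) ^ ηa + rvS δ ^ 12 * vS ρ₀ δ) := by ring
      _ ≤ (Ca + vS ρ₀ δ + 1) ^ 2 *
            ((400 * A * (δ ^ (1 / 2 : ℝ) * rvS δ ^ (N + 1))) ^ ηa + rvS δ ^ 12 * vS ρ₀ δ) := by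
          gcongr

/-- `(rvS δ)⁻¹ → 0`. -/
theorem tendsto_inv_rvS : Tendsto (fun δ : ℝ => (rvS δ)⁻¹) (𝓝[>] 0) (𝓝 0) := by
  have h1 : Tendsto (fun δ : ℝ => |Real.log δ|) (𝓝[>] 0) atTop :=
    tendsto_abs_atBot_atTop.comp Real.tendsto_log_nhdsGT_zero
  have h2 : Tendsto (fun δ : ℝ => Real.sqrt |Real.log δ|) (𝓝[>] 0) atTop :=
    Real.tendsto_sqrt_atTop.comp h1
  have h3 : Tendsto rvS (𝓝[>] 0) atTop := h2.const_mul_atTop (by norm_num)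
  exact h3.inv_tendsto_atTop

/-- The defect bound `pS` is nonnegative. -/
theorem pS_nonneg' (A W W' Λ m δ : ℝ) (hA : 0 ≤ A) (hW : 0 ≤ W) (hW' : 0 ≤ W') (hΛ : 0 ≤ Λ) :
    0 ≤ pS A W W' Λ m δ := by
  have hr := rvS_nonneg δ
  unfold pS τS τS'
  positivity

/-- Algebraic normal form of `pS / (δ² rvS¹⁴)`. -/
theorem pS_div_eq (A W W' Λ m δ : ℝ) (hW : W ≠ 0) (hW' : W' ≠ 0) (hΛ : Λ ≠ 0) (hm : m ≠ 0)
    (hδ : δ ≠ 0) (hr : rvS δ ≠ 0) :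
    pS A W W' Λ m δ / (δ ^ 2 * rvS δ ^ 14) =
      (144 * Real.pi) ^ 4 * (8 * W / 3) * (4 * (A + 2) * (rvS δ)⁻¹ ^ 2 + 8 * W * δ ^ 2) ^ 2 +
      2048 * Real.pi ^ 2 * W ^ 2 * (4 * (A + 6) * δ * (rvS δ)⁻¹ ^ 3 + 8 * W * δ ^ 3 * (rvS δ)⁻¹) ^ 2 +
      (144 * Real.pi * Λ / m ^ 2) ^ 4 * (8 * W' * Λ ^ 4 / 3) *
        (4 * Λ * (A + 2) * (rvS δ)⁻¹ ^ 2 + 8 * W' * Λ ^ 3 * δ ^ 2) ^ 2 +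
      2048 * Real.pi ^ 2 * W' ^ 2 * Λ ^ 6 / m ^ 4 *
        (4 * Λ * (A + 6) * δ * (rvS δ)⁻¹ ^ 3 + 8 * W' * Λ ^ 3 * δ ^ 3 * (rvS δ)⁻¹) ^ 2 := by
  have hτ : τS W δ = 8 * W * δ ^ 2 * rvS δ ^ 3 := by unfold τS; ring
  have hτ' : τS' W' Λ δ = 8 * W' * Λ ^ 3 * δ ^ 2 * rvS δ ^ 3 := by unfold τS'; ring
  unfold pS
  rw [hτ, hτ', div_eq_iff (by positivity)]
  field_simp
  ring

/-- `pS / (δ² rvS¹⁴)` converges (it is a polynomial in `(rvS δ)⁻¹` and `δ`). -/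
theorem tendsto_pS_div (A W W' Λ m : ℝ) (hW : 0 < W) (hW' : 0 < W') (hΛ : 1 ≤ Λ) (hm : 0 < m) :
    Tendsto (fun δ : ℝ => pS A W W' Λ m δ / (δ ^ 2 * rvS δ ^ 14)) (𝓝[>] 0) (𝓝 0) := by
  have hc : Continuous (fun p : ℝ × ℝ =>
      (144 * Real.pi) ^ 4 * (8 * W / 3) * (4 * (A + 2) * p.1 ^ 2 + 8 * W * p.2 ^ 2) ^ 2 +
      2048 * Real.pi ^ 2 * W ^ 2 * (4 * (A + 6) * p.2 * p.1 ^ 3 + 8 * W * p.2 ^ 3 * p.1) ^ 2 +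
      (144 * Real.pi * Λ / m ^ 2) ^ 4 * (8 * W' * Λ ^ 4 / 3) *
        (4 * Λ * (A + 2) * p.1 ^ 2 + 8 * W' * Λ ^ 3 * p.2 ^ 2) ^ 2 +
      2048 * Real.pi ^ 2 * W' ^ 2 * Λ ^ 6 / m ^ 4 *
        (4 * Λ * (A + 6) * p.2 * p.1 ^ 3 + 8 * W' * Λ ^ 3 * p.2 ^ 3 * p.1) ^ 2) := by
    fun_prop
  have hδ0 : Tendsto (fun δ : ℝ => δ) (𝓝[>] 0) (𝓝 0) :=
    tendsto_nhdsWithin_of_tendsto_nhds tendsto_id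
  have ht := (hc.tendsto ((0 : ℝ), (0 : ℝ))).comp (tendsto_inv_rvS.prodMk_nhds hδ0)
  simp only [ne_eq, OfNat.ofNat_ne_zero, not_false_eq_true, zero_pow, mul_zero, add_zero] at ht
  refine ht.congr' ?_
  filter_upwards [eventually_mesh_small] with δ ⟨hδ, _, _, hr6⟩
  rw [Function.comp_apply,
    pS_div_eq A W W' Λ m δ hW.ne' hW'.ne' (by linarith) hm.ne' hδ.ne' (by linarith)]

/-- `NS ≥ 0`. -/
theorem NS_nonneg' (A δ : ℝ) : 0 ≤ NS A δ := by
  unfold NS; positivity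

/-- Majorant of the number of squares in range: `δ rvS² NS` is eventually bounded. -/
theorem NS_bound (A δ : ℝ) (hA : 0 < A) (hδ : 0 < δ) (hr : 0 < rvS δ)
    (hsmall : Real.sqrt δ * rvS δ ≤ 1) :
    δ * rvS δ ^ 2 * NS A δ ≤ (2 / A + 5) ^ 2 := by
  have hq : 0 < Real.sqrt δ := Real.sqrt_pos.mpr hδ
  have hqq : Real.sqrt δ ^ 2 = δ := Real.sq_sqrt hδ.le
  have hq0 : Real.sqrt δ ≠ 0 := hq.ne'
  have hr0 : rvS δ ≠ 0 := hr.ne'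
  have hA0 : A ≠ 0 := hA.ne'
  have key : Real.sqrt δ ^ 2 * rvS δ ^ 2 * NS A δ = (2 / A + 5 * (Real.sqrt δ * rvS δ)) ^ 2 := by
    unfold NS RS
    field_simp
    ring
  rw [hqq] at key
  rw [key]
  have h0 : 0 ≤ 2 / A + 5 * (Real.sqrt δ * rvS δ) := by positivity
  have h1 : 2 / A + 5 * (Real.sqrt δ * rvS δ) ≤ 2 / A + 5 := by linarith
  exact pow_le_pow_left₀ h0 h1 2

/-- `cardS ≥ 0`. -/
theorem cardS_nonneg' (ρ₀ A δ : ℝ) : 0 ≤ cardS ρ₀ A δ := by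
  unfold cardS; positivity

/-- Majorant of the number of squares of the box: `δ² rvS² cardS` is eventually bounded. -/
theorem cardS_bound (ρ₀ A δ : ℝ) (hρ : 0 ≤ ρ₀) (hA : 0 < A) (hδ : 0 < δ) (hr : 0 < rvS δ)
    (hsmall : δ * rvS δ ≤ 1) :
    δ ^ 2 * rvS δ ^ 2 * cardS ρ₀ A δ ≤ (2 * ρ₀ / A + 3) ^ 2 := by
  have hM : ((MS ρ₀ A δ : ℕ) : ℝ) < ρ₀ / (δ * (A * rvS δ)) + 1 := by
    unfold MS
    exact Nat.ceil_lt_add_one (by positivity)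
  unfold cardS
  push_cast
  have hM' : δ * rvS δ * (MS ρ₀ A δ : ℝ) ≤ ρ₀ / A + δ * rvS δ := by
    have := mul_le_mul_of_nonneg_left hM.le (by positivity : 0 ≤ δ * rvS δ)
    calc δ * rvS δ * (MS ρ₀ A δ : ℝ) ≤ δ * rvS δ * (ρ₀ / (δ * (A * rvS δ)) + 1) := this
      _ = ρ₀ / A + δ * rvS δ := by field_simp
  have h1 : δ * rvS δ * (2 * (MS ρ₀ A δ : ℝ) + 1) ≤ 2 * ρ₀ / A + 3 := by
    have : δ * rvS δ * (2 * (MS ρ₀ A δ : ℝ) + 1) =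
        2 * (δ * rvS δ * (MS ρ₀ A δ : ℝ)) + δ * rvS δ := by
      ring
    rw [this]
    have : 2 * ρ₀ / A = 2 * (ρ₀ / A) := by ring
    rw [this]
    linarith
  have h0 : 0 ≤ δ * rvS δ * (2 * (MS ρ₀ A δ : ℝ) + 1) := by positivity
  calc δ ^ 2 * rvS δ ^ 2 * (2 * (MS ρ₀ A δ : ℝ) + 1) ^ 2
      = (δ * rvS δ * (2 * (MS ρ₀ A δ : ℝ) + 1)) ^ 2 := by ring
    _ ≤ (2 * ρ₀ / A + 3) ^ 2 := pow_le_pow_left₀ h0 h1 2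

/-- `FS ≥ 0`. -/
theorem FS_nonneg' (A W W' Λ m Ca ηa ρ₀ δ : ℝ) (hA : 0 ≤ A) (hW : 0 ≤ W) (hW' : 0 ≤ W')
    (hΛ : 0 ≤ Λ) (hCa : 0 ≤ Ca) : 0 ≤ FS A W W' Λ m Ca ηa ρ₀ δ := by
  have h1 := vS_nonneg' ρ₀ δ
  have h2 := pS_nonneg' A W W' Λ m δ hA hW hW' hΛ
  have h3 := BS_nonneg' A Ca ηa ρ₀ δ hA hCa
  have h4 := NS_nonneg' A δ
  have h5 := cardS_nonneg' ρ₀ A δ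
  unfold FS
  positivity

/-- **The final error of the one-arm route tends to zero with the mesh** (registered stub): `FS(δ) = vS + cardS·(3 pS BS + NS pS² BS + NS² pS³) → 0` as `δ → 0⁺` — every factor is an explicit power of `|log δ|` times a positive power of `δ`, except the decaying `vS` (`∝ δ^{4π−2}`) and `BS` (`∝ (δ |log δ|)^{ηa/2}`). -/
theorem FS_tendsto_zero : ∀ (A W W' Λ m Ca ηa ρ₀ : ℝ), 0 < A → 0 < W → 0 < W' → 1 ≤ Λ → 0 < m → 0 ≤ Ca → 0 < ηa → 0 < ρ₀ → Filter.Tendsto (fun δ : ℝ => FS A W W' Λ m Ca ηa ρ₀ δ) (nhdsWithin 0 (Set.Ioi 0)) (nhds 0) := by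
  intro A W W' Λ m Ca ηa ρ₀ hA hW hW' hΛ hm hCa hη hρ
  -- the limits of the building blocks
  have hv : Tendsto (fun δ : ℝ => vS ρ₀ δ) (𝓝[>] 0) (𝓝 0) := by
    simpa using tendsto_rvS_pow_mul_vS ρ₀ hρ.le 0
  have hp := tendsto_pS_div A W W' Λ m hW hW' hΛ hm
  have hX := tendsto_rvS_pow_mul_BS A Ca ηa ρ₀ hA hCa hη hρ
  have hY : Tendsto (fun δ : ℝ => δ * rvS δ ^ 24 * BS A Ca ηa ρ₀ δ) (𝓝[>] 0) (𝓝 0) := by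
    have h := (tendsto_rpow_mul_rvS_pow 1 12 one_pos).mul hX
    rw [mul_zero] at h
    refine h.congr' ?_
    filter_upwards [self_mem_nhdsWithin] with δ _
    rw [Real.rpow_one]
    ring
  have hZ : Tendsto (fun δ : ℝ => δ ^ 2 * rvS δ ^ 36) (𝓝[>] 0) (𝓝 0) := by
    refine (tendsto_rpow_mul_rvS_pow 2 36 two_pos).congr' ?_
    filter_upwards [self_mem_nhdsWithin] with δ _
    rw [Real.rpow_two]
  -- eventual smallness of the two scale ratios
  have e1 : ∀ᶠ δ in 𝓝[>] (0 : ℝ), δ * rvS δ ≤ 1 := by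
    filter_upwards [(tendsto_rpow_mul_rvS_pow 1 1 one_pos).eventually
      (eventually_le_nhds one_pos)] with δ h
    simpa [Real.rpow_one] using h
  have e2 : ∀ᶠ δ in 𝓝[>] (0 : ℝ), Real.sqrt δ * rvS δ ≤ 1 := by
    filter_upwards [(tendsto_rpow_mul_rvS_pow (1 / 2) 1 one_half_pos).eventually
      (eventually_le_nhds one_pos)] with δ h
    simpa [Real.sqrt_eq_rpow] using h
  set Cc : ℝ := (2 * ρ₀ / A + 3) ^ 2 with hCc
  set Cn : ℝ := (2 / A + 5) ^ 2 with hCn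
  -- the majorant and its limit
  have hG : Tendsto (fun δ : ℝ => vS ρ₀ δ + Cc *
      (3 * (pS A W W' Λ m δ / (δ ^ 2 * rvS δ ^ 14)) * (rvS δ ^ 12 * BS A Ca ηa ρ₀ δ) +
        Cn * (pS A W W' Λ m δ / (δ ^ 2 * rvS δ ^ 14)) ^ 2 *
          (δ * rvS δ ^ 24 * BS A Ca ηa ρ₀ δ) +
        Cn ^ 2 * (pS A W W' Λ m δ / (δ ^ 2 * rvS δ ^ 14)) ^ 3 * (δ ^ 2 * rvS δ ^ 36)))
      (𝓝[>] 0) (𝓝 0) := by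
    have h := hv.add ((((((hp.const_mul 3).mul hX).add (((hp.pow 2).const_mul Cn).mul hY)).add
      (((hp.pow 3).const_mul (Cn ^ 2)).mul hZ)).const_mul Cc))
    simpa using h
  refine squeeze_zero' ?_ ?_ hG
  · filter_upwards [self_mem_nhdsWithin] with δ _
    exact FS_nonneg' A W W' Λ m Ca ηa ρ₀ δ hA.le hW.le hW'.le (by linarith) hCa
  · filter_upwards [eventually_mesh_small, e1, e2] with δ ⟨hδ, hδ1, hL, hr6⟩ hε1 hε2
    have hr : 0 < rvS δ := by linarith
    have hc := cardS_bound ρ₀ A δ hρ.le hA hδ hr hε1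
    have hn := NS_bound A δ hA hδ hr hε2
    have hp0 := pS_nonneg' A W W' Λ m δ hA.le hW.le hW'.le (by linarith)
    have hB0 := BS_nonneg' A Ca ηa ρ₀ δ hA.le hCa
    have hN0 := NS_nonneg' A δ
    have hcard0 := cardS_nonneg' ρ₀ A δ
    have key : FS A W W' Λ m Ca ηa ρ₀ δ = vS ρ₀ δ + δ ^ 2 * rvS δ ^ 2 * cardS ρ₀ A δ *
        (3 * (pS A W W' Λ m δ / (δ ^ 2 * rvS δ ^ 14)) * (rvS δ ^ 12 * BS A Ca ηa ρ₀ δ) +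
          δ * rvS δ ^ 2 * NS A δ * (pS A W W' Λ m δ / (δ ^ 2 * rvS δ ^ 14)) ^ 2 *
            (δ * rvS δ ^ 24 * BS A Ca ηa ρ₀ δ) +
          (δ * rvS δ ^ 2 * NS A δ) ^ 2 * (pS A W W' Λ m δ / (δ ^ 2 * rvS δ ^ 14)) ^ 3 *
            (δ ^ 2 * rvS δ ^ 36)) := by
      have hδ0 : δ ≠ 0 := hδ.ne'
      have hr0 : rvS δ ≠ 0 := hr.ne'
      unfold FS
      field_simp
    rw [key]
    gcongr

end Summit.CriticalPhenomena.CardyFormulaZ2.Cruxes.VoronoiHubFromSmirnov.MoebiusExactDelaunayDilationWard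

end
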